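import Mathlib
import Summits.AtomisticToContinuum.FouriersLaw.Theses.EmbeddedDrudeMourre
import Summits.AtomisticToContinuum.FouriersLaw.Theorems.EmbeddedDrudeMourreDrudeDissolutionStubExcursionSecondDifferenceTubeDiag
import HarnessLib

/-!
# Volume of the corner balls `{d∓ < η²}` in the cell
# (stub B1b″ of line `kinetic-polymer-gas-on-the-time-axis`, request R2 of the sup-norm engine)
(crux `EmbeddedDrudeMourre.DrudeDissolution`, item stmt-AtomisticToContinuum-12593; `--supports` file, closes
nothing; lead c13)

WHAT. On the cell `(−π,π]³` (product Lebesgue measure, points read as `p = (k₁,(k₃,k₂))`), for every `η > 0`: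
`μ_cell {p | (1 − cos p.1) + (1 − cos p.2.2) + (1 + cos p.2.1) < η²} ≤ 64π³η³` (`cellMeasure_corner_minus_le`) and
`μ_cell {p | (1 + cos p.1) + (1 + cos p.2.2) + (1 − cos p.2.1) < η²} ≤ 64π³η³` (`cellMeasure_corner_plus_le`).

HOW. `1 ∓ cos x = 2 sin²((x − y)/2)` with `y = 0` resp. `y = π`, so the set lies in the product of three 1-D windows
`{|sin((x − y)/2)| < η}` of cell-measure `≤ 4πη` each (`volume_cell_abs_sin_half_lt_le`), and `Measure.prod_prod`.
-/

noncomputable section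

open MeasureTheory Set Real
open Literature.MathematicalPhysics.KineticTheory
open Literature.MathematicalPhysics.KineticTheory.PhononBoltzmann

namespace Summit.AtomisticToContinuum.FouriersLaw.Theorems.DrudeDissolution.KineticPolymerGasOnTheTimeAxis

/-- `1 − cos x < η² ⇒ |sin((x − 0)/2)| < η` (`η > 0`). [folklore] -/
theorem abs_sin_half_lt_of_one_sub_cos_lt {x η : ℝ} (hη : 0 < η) (h : 1 - Real.cos x < η ^ 2) :
    |Real.sin ((x - 0) / 2)| < η := by
  rw [sub_zero]
  have h1 : 1 - Real.cos x = 2 * Real.sin (x / 2) ^ 2 := by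
    rw [Real.sin_sq_eq_half_sub, show 2 * (x / 2) = x by ring]; ring
  have h2 : Real.sin (x / 2) ^ 2 < η ^ 2 := by nlinarith [sq_nonneg (Real.sin (x / 2))]
  exact abs_lt_of_sq_lt_sq' h2 hη.le |>.elim fun a b => abs_lt.2 ⟨a, b⟩

/-- `1 + cos x < η² ⇒ |sin((x − π)/2)| < η` (`η > 0`). [folklore] -/
theorem abs_sin_half_lt_of_one_add_cos_lt {x η : ℝ} (hη : 0 < η) (h : 1 + Real.cos x < η ^ 2) :
    |Real.sin ((x - Real.pi) / 2)| < η := by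
  have h1 : 1 + Real.cos x = 2 * Real.sin ((x - Real.pi) / 2) ^ 2 := by
    rw [Real.sin_sq_eq_half_sub, show 2 * ((x - Real.pi) / 2) = x - Real.pi by ring, Real.cos_sub_pi]; ring
  have h2 : Real.sin ((x - Real.pi) / 2) ^ 2 < η ^ 2 := by nlinarith [sq_nonneg (Real.sin ((x - Real.pi) / 2))]
  exact abs_lt_of_sq_lt_sq' h2 hη.le |>.elim fun a b => abs_lt.2 ⟨a, b⟩

/-- The product of three 1-D windows has cell-measure at most `(4πη)³ = 64π³η³`. [folklore] -/
theorem cellMeasure_window_prod_le {y₁ y₂ y₃ η : ℝ} (hy₁ : y₁ ∈ Ioc (-Real.pi) Real.pi)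
    (hy₂ : y₂ ∈ Ioc (-Real.pi) Real.pi) (hy₃ : y₃ ∈ Ioc (-Real.pi) Real.pi) (hη : 0 < η) :
    ((volume.restrict (Set.Ioc (-Real.pi) Real.pi)).prod
        ((volume.restrict (Set.Ioc (-Real.pi) Real.pi)).prod (volume.restrict (Set.Ioc (-Real.pi) Real.pi))))
      ({x : ℝ | |Real.sin ((x - y₁) / 2)| < η} ×ˢ
        ({x : ℝ | |Real.sin ((x - y₂) / 2)| < η} ×ˢ {x : ℝ | |Real.sin ((x - y₃) / 2)| < η})) ≤
      ENNReal.ofReal (64 * Real.pi ^ 3 * η ^ 3) := by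
  have hπ := Real.pi_pos
  rw [Measure.prod_prod, Measure.prod_prod]
  have h1 := volume_cell_abs_sin_half_lt_le hy₁ hη
  have h2 := volume_cell_abs_sin_half_lt_le hy₂ hη
  have h3 := volume_cell_abs_sin_half_lt_le hy₃ hη
  calc _ ≤ ENNReal.ofReal (4 * Real.pi * η) * (ENNReal.ofReal (4 * Real.pi * η) * ENNReal.ofReal (4 * Real.pi * η)) := by
        gcongr
    _ = ENNReal.ofReal (64 * Real.pi ^ 3 * η ^ 3) := by
        rw [← ENNReal.ofReal_mul (by positivity), ← ENNReal.ofReal_mul (by positivity)]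
        congr 1; ring

/-- **Registered sub-goal `cellMeasure_corner_minus_le` (request R2): the corner ball around the extremal minimum is
`O(η³)`.** For `η > 0`: `μ_cell {p | (1 − cos p.1) + (1 − cos p.2.2) + (1 + cos p.2.1) < η²} ≤ 64π³η³`. [folklore] -/
theorem cellMeasure_corner_minus_le :
    ∀ η : ℝ, 0 < η →
      ((volume.restrict (Set.Ioc (-Real.pi) Real.pi)).prod
          ((volume.restrict (Set.Ioc (-Real.pi) Real.pi)).prod (volume.restrict (Set.Ioc (-Real.pi) Real.pi))))
        {p : ℝ × ℝ × ℝ | (1 - Real.cos p.1) + (1 - Real.cos p.2.2) + (1 + Real.cos p.2.1) < η ^ 2} ≤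
      ENNReal.ofReal (64 * Real.pi ^ 3 * η ^ 3) := by
  intro η hη
  have hπ := Real.pi_pos
  have h0 : (0 : ℝ) ∈ Ioc (-Real.pi) Real.pi := ⟨by linarith, hπ.le⟩
  have hπm : Real.pi ∈ Ioc (-Real.pi) Real.pi := ⟨by linarith, le_rfl⟩
  have hsub : {p : ℝ × ℝ × ℝ | (1 - Real.cos p.1) + (1 - Real.cos p.2.2) + (1 + Real.cos p.2.1) < η ^ 2} ⊆
      {x : ℝ | |Real.sin ((x - 0) / 2)| < η} ×ˢ
        ({x : ℝ | |Real.sin ((x - Real.pi) / 2)| < η} ×ˢ {x : ℝ | |Real.sin ((x - 0) / 2)| < η}) := by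
    intro p hp
    simp only [mem_setOf_eq] at hp
    have c1 := Real.cos_le_one p.1
    have c2 := Real.cos_le_one p.2.2
    have c3 := Real.neg_one_le_cos p.2.1
    refine ⟨?_, ?_, ?_⟩
    · exact abs_sin_half_lt_of_one_sub_cos_lt hη (by linarith)
    · exact abs_sin_half_lt_of_one_add_cos_lt hη (by linarith)
    · exact abs_sin_half_lt_of_one_sub_cos_lt hη (by linarith)
  exact (measure_mono hsub).trans (cellMeasure_window_prod_le h0 hπm h0 hη)

/-- **Registered sub-goal `cellMeasure_corner_plus_le` (request R2): the corner ball around the extremal maximum is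
`O(η³)`.** For `η > 0`: `μ_cell {p | (1 + cos p.1) + (1 + cos p.2.2) + (1 − cos p.2.1) < η²} ≤ 64π³η³`. [folklore] -/
theorem cellMeasure_corner_plus_le :
    ∀ η : ℝ, 0 < η →
      ((volume.restrict (Set.Ioc (-Real.pi) Real.pi)).prod
          ((volume.restrict (Set.Ioc (-Real.pi) Real.pi)).prod (volume.restrict (Set.Ioc (-Real.pi) Real.pi))))
        {p : ℝ × ℝ × ℝ | (1 + Real.cos p.1) + (1 + Real.cos p.2.2) + (1 - Real.cos p.2.1) < η ^ 2} ≤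
      ENNReal.ofReal (64 * Real.pi ^ 3 * η ^ 3) := by
  intro η hη
  have hπ := Real.pi_pos
  have h0 : (0 : ℝ) ∈ Ioc (-Real.pi) Real.pi := ⟨by linarith, hπ.le⟩
  have hπm : Real.pi ∈ Ioc (-Real.pi) Real.pi := ⟨by linarith, le_rfl⟩
  have hsub : {p : ℝ × ℝ × ℝ | (1 + Real.cos p.1) + (1 + Real.cos p.2.2) + (1 - Real.cos p.2.1) < η ^ 2} ⊆
      {x : ℝ | |Real.sin ((x - Real.pi) / 2)| < η} ×ˢ
        ({x : ℝ | |Real.sin ((x - 0) / 2)| < η} ×ˢ {x : ℝ | |Real.sin ((x - Real.pi) / 2)| < η}) := by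
    intro p hp
    simp only [mem_setOf_eq] at hp
    have c1 := Real.neg_one_le_cos p.1
    have c2 := Real.neg_one_le_cos p.2.2
    have c3 := Real.cos_le_one p.2.1
    refine ⟨?_, ?_, ?_⟩
    · exact abs_sin_half_lt_of_one_add_cos_lt hη (by linarith)
    · exact abs_sin_half_lt_of_one_sub_cos_lt hη (by linarith)
    · exact abs_sin_half_lt_of_one_add_cos_lt hη (by linarith)
  exact (measure_mono hsub).trans (cellMeasure_window_prod_le hπm h0 hπm hη)

end Summit.AtomisticToContinuum.FouriersLaw.Theorems.DrudeDissolution.KineticPolymerGasOnTheTimeAxis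

end
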